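import Literature.NumberTheory.GaloisCohomology.CupProductMuPadicCharacter
import Literature.NumberTheory.EllipticCurves.CompactSelmerKummerDescent
import HarnessLib

/-!
# `ℤ_p(1)(K̄)` as a `ℤ_p`-line: the Galois action is the twist by the cyclotomic character, and a compatible system
# of primitive roots of unity `ε` gives `a ↦ ε^a : ℤ_p ≃ ℤ_p(1)`

Topic `NumberTheory/GaloisCohomology`; namespace `Literature.NumberTheory.GaloisCohomology`. Sequel of
`LocalInvariantMapPadic.lean` (`tateModuleMuPadic K p = lim_k μ_{p^k}(K̄)`) and `CupProductMuPadicCharacter.lean` (the twist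
`twistHom K p : ℤ_p(1) →+ ℤ_p →+ ℤ_p(1)`, `(ζ, a) ↦ ζ^a`). Definitions with bodies and theorems; no named fact, no instance, no
`sorry`.

* `twistHom_one` (`ζ^1 = ζ`), `twistHom_twistHom` (`(ζ^a)^b = ζ^{ab}`): `ℤ_p(1)(K̄)` is a `ℤ_p`-module through `twistHom` (stated as
  identities; no `Module` instance is registered, D-0014 typer rule);
* ★ `tateModuleMuPadic_apply_eq_twistHom` — **the Galois action on `ℤ_p(1)(K̄)` is the cyclotomic twist**: `σ ζ = ζ^{χ_p(σ)}` for the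
  tree's `GaloisRep.cyclotomicCharacter K p` (`char K ≠ p`; Mathlib `cyclotomicCharacter.spec` levelwise) — `ℤ_p(1) ≅ ℤ_p(χ_p)`;
* `IsPrimitiveSystem K p ε` — every coordinate `ε_k` is a PRIMITIVE `p^k`-th root of unity; for such `ε`:
  ★ `twistHom_injective_of_isPrimitiveSystem`, ★ `twistHom_surjective_of_isPrimitiveSystem` (discrete logarithms levelwise, glued
  `p`-adically), `padicLineEquiv K p ε hε : ℤ_p ≃+ ℤ_p(1)(K̄)`, `a ↦ ε^a`, a homeomorphism (`continuous_padicLineEquiv`,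
  `continuous_padicLineEquiv_symm`: continuous bijection from the compact `ℤ_p` to the Hausdorff limit), with
  ★ `tateModuleMuPadic_padicLineEquiv`: `σ(ε^a) = ε^{χ_p(σ) a}`.

This is the coordinate `ℤ_p(1) = ℤ_p · ε` in which period maps `ℤ_p(1) → B_dR⁺`, `ε^a ↦ a · t` (`t = log[ε]`), and `ℤ_p`-valued
coordinates of `ℤ_p(1)`-valued pairings (the Weil pairing `e_∞ = ε^{ẽ}`) are written — bookkeeping for Kato's reciprocity law
(LNM 1553, Ch. II §1.4; line `kato_lever` of crux K★ stmt-BirchSwinnertonDyer-22226). BSD is not proved by any of this.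

## References
* K. Kato, LNM 1553 (1993), Ch. II 1.4.2. [Kato1993LNM1553]
* J.-P. Serre, *Abelian ℓ-adic representations and elliptic curves* (1968), Ch. I §1.2 (`ℤ_ℓ(1)`, `χ_ℓ`). [Serre1968]
* J. Neukirch, A. Schmidt, K. Wingberg, *Cohomology of Number Fields*, 2nd ed. (2008), II §7 (2.7.5), VII (7.3.6) (`ℤ_p(1)`).
  [NeukirchSchmidtWingberg2008]
-/

noncomputable section

open CategoryTheory Function Field
open scoped NumberField

namespace Literature.NumberTheory.GaloisCohomology

open _root_.TopRep _root_.ContRepresentation _root_.ContinuousCohomology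
open Literature.NumberTheory.GaloisRepresentations
open Literature.NumberTheory.GaloisRepresentations.DiscreteGaloisModule
open Literature.AnabelianGeometry.AbsoluteAnabelian

variable (K : Type) [Field K] (p : ℕ) [hp : Fact p.Prime]

/-- `p^k ≠ 0`: instance bookkeeping for the levels. [folklore] -/
private theorem neZero_pow₆ (k : ℕ) : NeZero (p ^ k) := ⟨pow_ne_zero k hp.out.ne_zero⟩

attribute [local instance] neZero_pow₆

/-- `μ_n(K̄)` is killed by `n` (integer multiples). [folklore] -/
private theorem natCast_zsmul_muCarrier' {n : ℕ} (v : MuCarrier K n) : (n : ℤ) • v = 0 := by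
  rw [natCast_zsmul]
  exact muVal_injective K n (by rw [muVal_nsmul, muVal_pow_eq_one, muVal_zero])

/-- On an `n`-torsion element an integer multiple only depends on the multiplier modulo `n`. [folklore] -/
private theorem natMod_zsmul_eq' {M : Type*} [AddCommGroup M] {n : ℕ} (m : ℕ) (x : M) (hx : (n : ℤ) • x = 0) :
    ((m % n : ℕ) : ℤ) • x = (m : ℤ) • x := by
  conv_rhs => rw [← Nat.mod_add_div m n, Nat.cast_add, add_zsmul, Nat.cast_mul, mul_comm, mul_zsmul, hx, zsmul_zero,
    add_zero]

/-- The underlying unit of the level-`k` coordinate of `ζ^a` is `(ζ_k)^{(a mod p^k)}`. [cite: Kato1993LNM1553, Ch. II 1.4.2] -/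
theorem muVal_twistCoord (k : ℕ) (ζ : (muPadicSystem K p).limit) (a : ℤ_[p]) :
    muVal K (p ^ k) (twistCoord K p k ζ a) =
      muVal K (p ^ k) ((ζ : ∀ k, MuCarrier K (p ^ k)) k) ^ (PadicInt.toZModPow k a).val := by
  rw [twistCoord_eq_zsmul, natCast_zsmul, muVal_nsmul]

/-! ### `ℤ_p(1)` as a `ℤ_p`-module through `twistHom` -/

/-- **`ζ^1 = ζ`.** [cite: Kato1993LNM1553, Ch. II 1.4.2] -/
theorem twistHom_one (ζ : (muPadicSystem K p).limit) : twistHom K p ζ 1 = ζ :=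
  Subtype.ext (funext fun k => by
    rw [coe_twistHom, twistCoord_eq_zsmul, map_one, ZMod.val_one_eq_one_mod,
      natMod_zsmul_eq' _ _ (natCast_zsmul_muCarrier' K _), Nat.cast_one, one_zsmul])

/-- **`(ζ^a)^b = ζ^{a b}`** (`μ_{p^k}` is `p^k`-torsion). [cite: Kato1993LNM1553, Ch. II 1.4.2] -/
theorem twistHom_twistHom (ζ : (muPadicSystem K p).limit) (a b : ℤ_[p]) :
    twistHom K p (twistHom K p ζ a) b = twistHom K p ζ (a * b) :=
  Subtype.ext (funext fun k => by
    rw [coe_twistHom, coe_twistHom, twistCoord_eq_zsmul, twistCoord_eq_zsmul, coe_twistHom, twistCoord_eq_zsmul,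
      map_mul, mul_comm, ← mul_zsmul, ← Nat.cast_mul, ZMod.val_mul,
      natMod_zsmul_eq' _ _ (natCast_zsmul_muCarrier' K _)])

/-! ### The Galois action on `ℤ_p(1)` is the cyclotomic twist -/

omit hp in
/-- Coordinates of the Galois action on `ℤ_p(1)(K̄)`: `(σ ζ)_k = σ ζ_k`. [cite: NeukirchSchmidtWingberg2008, II §7 (2.7.5)] -/
theorem coe_tateModuleMuPadic_apply (σ : absoluteGaloisGroup K) (ζ : (muPadicSystem K p).limit) (k : ℕ) :
    ((tateModuleMuPadic K p σ ζ : (muPadicSystem K p).limit) : ∀ k, MuCarrier K (p ^ k)) k =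
      mu K (p ^ k) σ ((ζ : ∀ k, MuCarrier K (p ^ k)) k) := rfl

/-- ★ **The Galois action on `ℤ_p(1)(K̄)` is the twist by the cyclotomic character**: `σ ζ = ζ^{χ_p(σ)}` for every
`ζ ∈ ℤ_p(1)(K̄) = lim_k μ_{p^k}(K̄)` and `σ ∈ G_K` (`char K ≠ p`), `χ_p = GaloisRep.cyclotomicCharacter K p` — levelwise Mathlib's
`cyclotomicCharacter.spec` (`σ t = t^{χ(σ) mod p^k}` for `t^{p^k} = 1`). So `ℤ_p(1) ≅ ℤ_p(χ_p)` as `G_K`-modules.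
[cite: Serre1968, Ch. I §1.2] [cite: NeukirchSchmidtWingberg2008, VII (7.3.6)] -/
theorem tateModuleMuPadic_apply_eq_twistHom [NeZero (p : K)] (σ : absoluteGaloisGroup K) (ζ : (muPadicSystem K p).limit) :
    tateModuleMuPadic K p σ ζ = twistHom K p ζ ((GaloisRep.cyclotomicCharacter K p σ : ℤ_[p]ˣ) : ℤ_[p]) :=
  Subtype.ext (funext fun k => by
    rw [coe_tateModuleMuPadic_apply, coe_twistHom]
    apply muVal_injective K (p ^ k)
    apply Units.ext
    rw [muVal_apply, muVal_twistCoord, Units.val_pow_eq_pow_val, Units.coe_smul]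
    exact GaloisRep.cyclotomicCharacter_spec (K := K) (ℓ := p) σ _ (by
      rw [← Units.val_pow_eq_pow_val, muVal_pow_eq_one, Units.val_one]))

/-! ### Compatible systems of primitive roots of unity and the isomorphism `ℤ_p ≃ ℤ_p(1)` -/

/-- **`ε ∈ ℤ_p(1)(K̄)` is a compatible system of PRIMITIVE roots of unity**: every coordinate `ε_k` is a primitive `p^k`-th root of
unity in `K̄` (a topological generator of `ℤ_p(1)`). [cite: Serre1968, Ch. I §1.2] -/
def IsPrimitiveSystem (ε : (muPadicSystem K p).limit) : Prop :=
  ∀ k, IsPrimitiveRoot ((muVal K (p ^ k) ((ε : ∀ k, MuCarrier K (p ^ k)) k) : (AlgebraicClosure K)ˣ) : AlgebraicClosure K)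
    (p ^ k)

variable {K p}

/-- The coordinates of two elements of `ℤ_p(1)` with the same `ε`-exponents agree; injectivity of `a ↦ ε^a` for a primitive system
(`ε_k^{a mod p^k} = ε_k^{b mod p^k}` forces `a ≡ b mod p^k`). [cite: Serre1968, Ch. I §1.2] -/
theorem twistHom_injective_of_isPrimitiveSystem {ε : (muPadicSystem K p).limit} (hε : IsPrimitiveSystem K p ε) :
    Injective (twistHom K p ε) := fun a b h => by
  refine PadicInt.ext_of_toZModPow.mp fun k => ZMod.val_injective _ ?_
  have hk := congrArg (fun ζ : (muPadicSystem K p).limit => muVal K (p ^ k) ((ζ : ∀ k, MuCarrier K (p ^ k)) k)) h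
  simp only [coe_twistHom, muVal_twistCoord] at hk
  exact (hε k).pow_inj (ZMod.val_lt _) (ZMod.val_lt _) (by
    rw [← Units.val_pow_eq_pow_val, ← Units.val_pow_eq_pow_val, hk])

/-- **Discrete logarithms, levelwise**: for a primitive system `ε` every `ζ ∈ ℤ_p(1)` has `ζ_k = n_k · ε_k` with `n_k < p^k`.
[cite: Serre1968, Ch. I §1.2] -/
theorem exists_coe_eq_nsmul_of_isPrimitiveSystem {ε : (muPadicSystem K p).limit} (hε : IsPrimitiveSystem K p ε)
    (ζ : (muPadicSystem K p).limit) (k : ℕ) :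
    ∃ n : ℕ, n < p ^ k ∧ (ζ : ∀ k, MuCarrier K (p ^ k)) k = n • (ε : ∀ k, MuCarrier K (p ^ k)) k := by
  obtain ⟨n, hn, h⟩ := (hε k).eq_pow_of_pow_eq_one
    (ξ := ((muVal K (p ^ k) ((ζ : ∀ k, MuCarrier K (p ^ k)) k) : (AlgebraicClosure K)ˣ) : AlgebraicClosure K))
    (by rw [← Units.val_pow_eq_pow_val, muVal_pow_eq_one, Units.val_one])
  refine ⟨n, hn, muVal_injective K (p ^ k) (Units.ext ?_)⟩
  rw [muVal_nsmul, Units.val_pow_eq_pow_val, h]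

/-- Successive discrete logarithms are compatible: if `ζ_{k+1} = m · ε_{k+1}` and `ζ_k = n · ε_k` (`n < p^k`) then `m ≡ n (mod p^k)`
(apply the `p`-th power map and use primitivity of `ε_k`). [cite: Serre1968, Ch. I §1.2] -/
theorem dlog_succ_modEq_of_isPrimitiveSystem {ε : (muPadicSystem K p).limit} (hε : IsPrimitiveSystem K p ε)
    (ζ : (muPadicSystem K p).limit) (k : ℕ) {m n : ℕ} (hn : n < p ^ k)
    (hm : (ζ : ∀ k, MuCarrier K (p ^ k)) (k + 1) = m • (ε : ∀ k, MuCarrier K (p ^ k)) (k + 1))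
    (hn' : (ζ : ∀ k, MuCarrier K (p ^ k)) k = n • (ε : ∀ k, MuCarrier K (p ^ k)) k) :
    (m : ℤ) ≡ (n : ℤ) [ZMOD (p : ℤ) ^ k] := by
  -- push `ζ_{k+1} = m · ε_{k+1}` down one level: `ζ_k = m · ε_k`
  have hred : (ζ : ∀ k, MuCarrier K (p ^ k)) k = m • (ε : ∀ k, MuCarrier K (p ^ k)) k := by
    rw [← (muPadicSystem K p).red_apply_coe ζ (Nat.le_succ k), hm, map_nsmul, (muPadicSystem K p).red_apply_coe ε]
  have hmn : m % p ^ k = n := by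
    refine (hε k).pow_inj (Nat.mod_lt _ (pow_pos hp.out.pos k)) hn ?_
    have h1 := congrArg (fun v => ((muVal K (p ^ k) v : (AlgebraicClosure K)ˣ) : AlgebraicClosure K)) (hred.symm.trans hn')
    simp only [muVal_nsmul, Units.val_pow_eq_pow_val] at h1
    rw [← pow_eq_pow_mod m (by rw [← Units.val_pow_eq_pow_val, muVal_pow_eq_one, Units.val_one]), h1]
  have hmod : m ≡ n [MOD p ^ k] := (hmn ▸ Nat.mod_modEq m (p ^ k)).symm
  have hdvd := (Nat.modEq_iff_dvd.mp hmod)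
  push_cast at hdvd
  exact Int.modEq_iff_dvd.mpr hdvd

/-- ★ **Surjectivity of `a ↦ ε^a`** for a primitive system `ε`: every `ζ ∈ ℤ_p(1)(K̄)` is `ε^a` for some `a ∈ ℤ_p` (the compatible
discrete logarithms glue to a `p`-adic integer, `ℤ_p = lim ℤ/p^k`). [cite: Serre1968, Ch. I §1.2] [cite: NeukirchSchmidtWingberg2008, II §7 (2.7.5)] -/
theorem twistHom_surjective_of_isPrimitiveSystem {ε : (muPadicSystem K p).limit} (hε : IsPrimitiveSystem K p ε) :
    Surjective (twistHom K p ε) := fun ζ => by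
  choose n hn hζ using exists_coe_eq_nsmul_of_isPrimitiveSystem hε ζ
  obtain ⟨a, ha⟩ := WeierstrassCurve.exists_padicInt_toZModPow_eq_intCast p (fun k => (n k : ℤ))
    (fun k => dlog_succ_modEq_of_isPrimitiveSystem hε ζ k (hn k) (hζ (k + 1)) (hζ k))
  refine ⟨a, Subtype.ext (funext fun k => ?_)⟩
  rw [coe_twistHom, twistCoord_eq_zsmul, ha k, Int.cast_natCast, ZMod.val_natCast,
    natMod_zsmul_eq' _ _ (natCast_zsmul_muCarrier' K _), natCast_zsmul, ← hζ k]

/-- ★ **`ℤ_p ≃ ℤ_p(1)(K̄)`, `a ↦ ε^a`, for a compatible system `ε` of primitive roots of unity** (additive equivalence).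
[cite: Serre1968, Ch. I §1.2] [cite: NeukirchSchmidtWingberg2008, VII (7.3.6)] -/
def padicLineEquiv (ε : (muPadicSystem K p).limit) (hε : IsPrimitiveSystem K p ε) : ℤ_[p] ≃+ (muPadicSystem K p).limit :=
  AddEquiv.ofBijective (twistHom K p ε)
    ⟨twistHom_injective_of_isPrimitiveSystem hε, twistHom_surjective_of_isPrimitiveSystem hε⟩

/-- `padicLineEquiv ε a = ε^a`. [cite: Serre1968, Ch. I §1.2] -/
@[simp] theorem padicLineEquiv_apply (ε : (muPadicSystem K p).limit) (hε : IsPrimitiveSystem K p ε) (a : ℤ_[p]) :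
    padicLineEquiv ε hε a = twistHom K p ε a := rfl

/-- `ε^{log_ε ζ} = ζ`. [cite: Serre1968, Ch. I §1.2] -/
theorem twistHom_padicLineEquiv_symm (ε : (muPadicSystem K p).limit) (hε : IsPrimitiveSystem K p ε)
    (ζ : (muPadicSystem K p).limit) : twistHom K p ε ((padicLineEquiv ε hε).symm ζ) = ζ :=
  (padicLineEquiv ε hε).apply_symm_apply ζ

/-- `log_ε (ε^a) = a`. [cite: Serre1968, Ch. I §1.2] -/
theorem padicLineEquiv_symm_twistHom (ε : (muPadicSystem K p).limit) (hε : IsPrimitiveSystem K p ε) (a : ℤ_[p]) :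
    (padicLineEquiv ε hε).symm (twistHom K p ε a) = a :=
  (padicLineEquiv ε hε).symm_apply_apply a

/-- `a ↦ ε^a` is continuous. [cite: NeukirchSchmidtWingberg2008, II §7 (2.7.5)] -/
theorem continuous_padicLineEquiv (ε : (muPadicSystem K p).limit) (hε : IsPrimitiveSystem K p ε) :
    Continuous (padicLineEquiv ε hε) :=
  (continuous_twistHom K p).comp (continuous_const.prodMk continuous_id)

/-- `log_ε : ℤ_p(1)(K̄) → ℤ_p` is continuous (a continuous bijection from the compact `ℤ_p` to the Hausdorff `ℤ_p(1)` is a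
homeomorphism). [cite: NeukirchSchmidtWingberg2008, II §7 (2.7.5)] -/
theorem continuous_padicLineEquiv_symm (ε : (muPadicSystem K p).limit) (hε : IsPrimitiveSystem K p ε) :
    Continuous (padicLineEquiv ε hε).symm :=
  Continuous.continuous_symm_of_equiv_compact_to_t2 (f := (padicLineEquiv ε hε).toEquiv) (continuous_padicLineEquiv ε hε)

/-- ★ **`σ(ε^a) = ε^{χ_p(σ) · a}`**: in the coordinate `a ↦ ε^a` the Galois action on `ℤ_p(1)(K̄)` is multiplication by the cyclotomic
character (`char K ≠ p`). [cite: Serre1968, Ch. I §1.2] [cite: NeukirchSchmidtWingberg2008, VII (7.3.6)] -/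
theorem tateModuleMuPadic_twistHom [NeZero (p : K)] (ε : (muPadicSystem K p).limit) (σ : absoluteGaloisGroup K) (a : ℤ_[p]) :
    tateModuleMuPadic K p σ (twistHom K p ε a) =
      twistHom K p ε (((GaloisRep.cyclotomicCharacter K p σ : ℤ_[p]ˣ) : ℤ_[p]) * a) := by
  rw [tateModuleMuPadic_apply_eq_twistHom, twistHom_twistHom, mul_comm]

/-- The same in terms of `log_ε`: `log_ε(σ ζ) = χ_p(σ) · log_ε(ζ)`. [cite: Serre1968, Ch. I §1.2] -/
theorem padicLineEquiv_symm_tateModuleMuPadic [NeZero (p : K)] (ε : (muPadicSystem K p).limit) (hε : IsPrimitiveSystem K p ε)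
    (σ : absoluteGaloisGroup K) (ζ : (muPadicSystem K p).limit) :
    (padicLineEquiv ε hε).symm (tateModuleMuPadic K p σ ζ) =
      ((GaloisRep.cyclotomicCharacter K p σ : ℤ_[p]ˣ) : ℤ_[p]) * (padicLineEquiv ε hε).symm ζ := by
  apply (padicLineEquiv ε hε).injective
  rw [AddEquiv.apply_symm_apply, padicLineEquiv_apply, ← tateModuleMuPadic_twistHom, twistHom_padicLineEquiv_symm]

/-! ### Existence of compatible systems of primitive roots of unity (`char K ≠ p`) -/

/-- **Step of the construction**: above a primitive `p^k`-th root `x` of unity in `K̄` there is a primitive `p^{k+1}`-th root `ζ` with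
`ζ^p = x` (`K̄` has enough roots of unity when `char K ≠ p`: take `η` primitive of order `p^{k+1}`, write `x = (η^p)^i` with `i`
prime to `p^k` — `i = 1` if `k = 0` — and set `ζ = η^i`). [cite: Serre1968, Ch. I §1.2] -/
theorem exists_isPrimitiveRoot_pow_eq [NeZero (p : K)] (k : ℕ) {x : AlgebraicClosure K} (hx : IsPrimitiveRoot x (p ^ k)) :
    ∃ ζ : AlgebraicClosure K, IsPrimitiveRoot ζ (p ^ (k + 1)) ∧ ζ ^ p = x := by
  obtain ⟨η, hη⟩ := HasEnoughRootsOfUnity.exists_primitiveRoot (AlgebraicClosure K) (p ^ (k + 1))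
  have hηp : IsPrimitiveRoot (η ^ p) (p ^ k) := hη.pow (pow_pos hp.out.pos _) (pow_succ' p k)
  rcases Nat.eq_zero_or_pos k with rfl | hk
  · refine ⟨η, hη, ?_⟩
    rw [pow_zero, IsPrimitiveRoot.one_right_iff] at hx
    rw [hx, ← IsPrimitiveRoot.one_right_iff, ← pow_zero p]
    exact hηp
  · obtain ⟨i, -, hi⟩ := hηp.eq_pow_of_pow_eq_one hx.pow_eq_one
    have hcop : i.Coprime (p ^ k) := (hηp.pow_iff_coprime (pow_pos hp.out.pos k) i).1 (hi ▸ hx)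
    refine ⟨η ^ i, hη.pow_of_coprime i ?_, by rw [← pow_mul, mul_comm, pow_mul, hi]⟩
    exact (Nat.coprime_pow_right_iff (Nat.succ_pos k) i p).2 ((Nat.coprime_pow_right_iff hk i p).1 hcop)

/-- A compatible sequence of primitive `p^k`-th roots of unity in `K̄` (`char K ≠ p`), by recursion on `k`.
[cite: Serre1968, Ch. I §1.2] -/
private noncomputable def primitiveSeq [NeZero (p : K)] :
    (k : ℕ) → {x : AlgebraicClosure K // IsPrimitiveRoot x (p ^ k)}
  | 0 => ⟨1, by rw [pow_zero]; exact IsPrimitiveRoot.one⟩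
  | k + 1 => ⟨(exists_isPrimitiveRoot_pow_eq (K := K) (p := p) k (primitiveSeq k).2).choose,
      (exists_isPrimitiveRoot_pow_eq (K := K) (p := p) k (primitiveSeq k).2).choose_spec.1⟩

/-- Compatibility of `primitiveSeq`: `ε_{k+1}^p = ε_k`. [cite: Serre1968, Ch. I §1.2] -/
private theorem primitiveSeq_succ_pow [NeZero (p : K)] (k : ℕ) :
    ((primitiveSeq (K := K) (p := p) (k + 1)).1) ^ p = (primitiveSeq (K := K) (p := p) k).1 :=
  (exists_isPrimitiveRoot_pow_eq (K := K) (p := p) k (primitiveSeq k).2).choose_spec.2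

/-- The coordinates of the constructed system, as elements of `μ_{p^k}(K̄)`. [cite: Serre1968, Ch. I §1.2] -/
private noncomputable def primitiveCoord [NeZero (p : K)] (k : ℕ) : MuCarrier K (p ^ k) :=
  MuCarrier.ofRootsOfUnity (rootsOfUnity.mkOfPowEq (primitiveSeq (K := K) (p := p) k).1 (primitiveSeq k).2.pow_eq_one)

/-- The underlying element of `K̄` of `primitiveCoord k` is `primitiveSeq k`. [cite: Serre1968, Ch. I §1.2] -/
private theorem coe_muVal_primitiveCoord [NeZero (p : K)] (k : ℕ) :
    ((muVal K (p ^ k) (primitiveCoord (K := K) (p := p) k) : (AlgebraicClosure K)ˣ) : AlgebraicClosure K) =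
      (primitiveSeq (K := K) (p := p) k).1 := rfl

/-- Successive compatibility of the coordinates under the `p`-th power map. [cite: Serre1968, Ch. I §1.2] -/
private theorem red_primitiveCoord_succ [NeZero (p : K)] (k : ℕ) :
    (muPadicSystem K p).red (n := k) (m := k + 1) (Nat.le_succ k) (primitiveCoord (K := K) (p := p) (k + 1)) =
      primitiveCoord (K := K) (p := p) k := by
  rw [muPadicSystem_red]
  apply muVal_injective K (p ^ k)
  apply Units.ext
  rw [muVal_muPow, Units.val_pow_eq_pow_val, coe_muVal_primitiveCoord, coe_muVal_primitiveCoord,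
    Nat.add_sub_cancel_left, pow_one, primitiveSeq_succ_pow]

variable (K p) in
/-- **A compatible system of primitive `p`-power roots of unity in `K̄`** (`char K ≠ p`), as an element of `ℤ_p(1)(K̄)`.
[cite: Serre1968, Ch. I §1.2] [cite: NeukirchSchmidtWingberg2008, VII (7.3.6)] -/
def primitiveSystem [NeZero (p : K)] : (muPadicSystem K p).limit :=
  ⟨fun k => primitiveCoord (K := K) (p := p) k, fun _ _ h =>
    (muPadicSystem K p).chain_compat (muPadicChain K p) (fun h => (muPadicSystem K p).red h)
      (muPadicSystem K p).red_refl (fun h₁ h₂ x => (muPadicSystem K p).red_trans h₁ h₂ x)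
      (fun k => primitiveCoord (K := K) (p := p) k) (fun k => red_primitiveCoord_succ (K := K) (p := p) k) h⟩

/-- ★ `primitiveSystem K p` IS a primitive system. [cite: Serre1968, Ch. I §1.2] -/
theorem isPrimitiveSystem_primitiveSystem [NeZero (p : K)] : IsPrimitiveSystem K p (primitiveSystem K p) := fun k =>
  (primitiveSeq (K := K) (p := p) k).2

/-- ★ **Compatible systems of primitive `p`-power roots of unity exist** in `K̄` when `char K ≠ p`; hence
`ℤ_p ≃ ℤ_p(1)(K̄)` (`padicLineEquiv`). [cite: Serre1968, Ch. I §1.2] [cite: NeukirchSchmidtWingberg2008, VII (7.3.6)] -/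
theorem exists_isPrimitiveSystem [NeZero (p : K)] : ∃ ε : (muPadicSystem K p).limit, IsPrimitiveSystem K p ε :=
  ⟨primitiveSystem K p, isPrimitiveSystem_primitiveSystem⟩

end Literature.NumberTheory.GaloisCohomology

end
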